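import Literature.AlgebraicGeometry.Resolution.StrictTransformFiniteFlatAdmissible
import Literature.AlgebraicGeometry.Resolution.BlowupsProduct
import Literature.AlgebraicGeometry.Resolution.BlowupsExistence
import Literature.AlgebraicGeometry.Resolution.MarkedIdealsLemmas
import HarnessLib

/-!
# Raynaud–Gruson flattening by a `U`-admissible blowing up for finite morphisms over an affine
# base: the existence statement (Stacks 081R, finite/affine case)

Topic: `Literature/AlgebraicGeometry/Resolution`. Packaging of
`StrictTransformFiniteFlatAdmissible.lean` into the shape of the named fact `Stacks081R`
(Raynaud–Gruson 1971, Thm. 5.2.2; Stacks, Tag 081R) for a FINITE morphism `f : X → S` of AFFINE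
schemes: with `R = Γ(S)`, `B = Γ(X)`, `I = Fit_r(B)`, and `K ⊆ R` a finitely generated ideal
with `Kᵐ ⊆ I` and `Kⁿ Fit_k(B) = 0` for `k < r` — i.e. `X` is finite locally free of rank `r`
over the quasi-compact open `U = S ∖ V(K)` — there is a blowing up `b : S' → S` of `S` in the
finitely generated (`I` finitely generated) centre `K · I`, whose support `V(K) = S ∖ U` is
disjoint from `U` (a `U`-admissible blowing up, Stacks 080K), such that the strict transform of
`X` along `b` is FLAT over `S'`. (Of the printed conclusion "flat and of finite presentation"
the flatness is proved here; finite presentation — the strict transform is in fact finite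
locally free of rank `r` over the charts — is not packaged in this file.)

* `ofIdealTop_mul_general` — `(K I)~ = K~ · I~` on any scheme (with the tree's `comap_mul`, pull-back of ideal
  sheaves is multiplicative, `MarkedIdealsLemmas.lean`);
* `exists_isBlowup_flat_blowupStrictTransformMap_of_isFinite` — **the `U`-admissible blowing up
  flattening a finite `X → S` over an affine base.**

## References

* M. Raynaud, L. Gruson, *Critères de platitude et de projectivité*, Invent. Math. 13 (1971),
  Première partie, Thm. 5.2.2. [RaynaudGruson1971]
* The Stacks Project, Tag 081R (Lemma 38.31.1), Tag 0811, Tag 080K, Tag 01OG. [StacksProject]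
-/

noncomputable section

open CategoryTheory CategoryTheory.Limits AlgebraicGeometry TopologicalSpace

namespace Literature.AlgebraicGeometry.Resolution

universe u

open Literature.RingTheory.FittingIdeal Literature.AlgebraicGeometry.Limits

/-! ## Products of ideal sheaves -/

/-- The ideal sheaf of a product of ideals of global sections is the product of the ideal
sheaves (on any scheme; a local copy generalising the affine-only
`Literature.AlgebraicGeometry.Resolution.ofIdealTop_mul` of `CobordantBlowup.lean`, whose imports
are unrelated to this file's). [folklore] -/
private theorem ofIdealTop_mul_general {X : Scheme.{u}} (K I : Ideal Γ(X, ⊤)) :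
    Scheme.IdealSheafData.ofIdealTop (K * I) =
      Scheme.IdealSheafData.ofIdealTop K * Scheme.IdealSheafData.ofIdealTop I := by
  refine Scheme.IdealSheafData.ext (funext fun U => ?_)
  rw [Scheme.IdealSheafData.ideal_mul, Pi.mul_apply, Scheme.IdealSheafData.ofIdealTop_ideal,
    Scheme.IdealSheafData.ofIdealTop_ideal, Scheme.IdealSheafData.ofIdealTop_ideal, Ideal.map_mul]

/-- A blowing up in `K · I` pulls `V(I)` back to an effective Cartier divisor (a factor of an
invertible ideal sheaf is invertible). [cite: StacksProject, Tag 080A] -/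
theorem isEffectiveCartier_comap_right_of_isBlowup_mul {S S' : Scheme.{u}} {b : S' ⟶ S}
    {K I : Ideal Γ(S, ⊤)} (hb : IsBlowup b (Scheme.IdealSheafData.ofIdealTop (K * I))) :
    IsEffectiveCartier ((Scheme.IdealSheafData.ofIdealTop I).comap b) := by
  have h := hb.isEffectiveCartier
  rw [ofIdealTop_mul_general, comap_mul] at h
  exact h.of_mul_right

/-! ## The existence statement -/

variable {X S : Scheme.{u}} [IsAffine X] [IsAffine S] (f : X ⟶ S)

/-- **Raynaud–Gruson flattening by a `U`-admissible blowing up, for a finite morphism over an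
affine base** (the named fact `Stacks081R` in this case, flatness part). Let `f : X → S` be a
finite morphism of affine schemes, `R = Γ(S)`, `B = Γ(X)`, `I = Fit_r(B)` finitely generated,
`K ⊆ R` finitely generated with `Kᵐ ⊆ I` and `Kⁿ Fit_k(B) = 0` for `k < r` (i.e. `X` is finite
locally free of rank `r` over `U = S ∖ V(K)`). Then there is a blowing up `b : S' → S` of `S` in
the ideal sheaf of `K · I` — of finite type, with support `V(K)` disjoint from `U` — such that
the strict transform of `X` along `b` is flat over `S'`.
[cite: RaynaudGruson1971, Première partie 5.2.2; StacksProject, Tag 081R] -/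
theorem exists_isBlowup_flat_blowupStrictTransformMap_of_isFinite [IsFinite f] {r : ℕ}
    {I K : Ideal Γ(S, ⊤)}
    (hI : letI := f.appTop.hom.toAlgebra; Module.fittingIdeal Γ(S, ⊤) Γ(X, ⊤) r = I)
    (hK : letI := f.appTop.hom.toAlgebra;
      ∀ k < r, ∃ n : ℕ, K ^ n * Module.fittingIdeal Γ(S, ⊤) Γ(X, ⊤) k = ⊥)
    (hKI : ∃ m : ℕ, K ^ m ≤ I) (hKfg : K.FG) (hIfg : I.FG) :
    ∃ (S' : Scheme.{u}) (b : S' ⟶ S),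
      IsBlowup b (Scheme.IdealSheafData.ofIdealTop (K * I)) ∧
      (∀ W : S.affineOpens, ((Scheme.IdealSheafData.ofIdealTop (K * I)).ideal W).FG) ∧
      Disjoint ((centreCompl (Scheme.IdealSheafData.ofIdealTop K) : S.Opens) : Set S)
        ((Scheme.IdealSheafData.ofIdealTop (K * I)).support : Set S) ∧
      Flat (blowupStrictTransformMap f b (Scheme.IdealSheafData.ofIdealTop (K * I))) := by
  obtain ⟨S', b, hb⟩ := Stacks01OG_holds S (Scheme.IdealSheafData.ofIdealTop (K * I))
  refine ⟨S', b, hb, fun W => ?_, ?_, ?_⟩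
  · rw [Scheme.IdealSheafData.ofIdealTop_ideal]
    exact (hKfg.mul hIfg).map _
  · -- `Supp (K I) = V(K) ∪ V(I) = V(K)` since `Kᵐ ⊆ I`
    obtain ⟨m, hm⟩ := hKI
    rw [Set.disjoint_left]
    intro x hxU hxC
    rw [ofIdealTop_mul_general, Scheme.IdealSheafData.support_mul] at hxC
    apply hxU
    rcases hxC with hxK | hxI
    · exact hxK
    · -- `V(I) ⊆ V(Kᵐ) = V(K)`
      rw [Scheme.IdealSheafData.coe_support_ofIdealTop, Scheme.mem_zeroLocus_iff] at hxI ⊢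
      intro g hg hxg
      refine hxI (g ^ m) (hm (Ideal.pow_mem_pow hg m)) ?_
      rw [Scheme.mem_basicOpen_top] at hxg ⊢
      rw [map_pow]
      exact hxg.pow m
  · exact flat_blowupStrictTransformMap_admissible_of_isFinite_of_isAffine f hI hK
      Ideal.mul_le_left Ideal.mul_le_right b hb.isEffectiveCartier
      (isEffectiveCartier_comap_right_of_isBlowup_mul hb)

end Literature.AlgebraicGeometry.Resolution

end
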